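import Summits.BirchSwinnertonDyer.BirchSwinnertonDyer.Theorems.GoldfeldGoodTwistsX049
import Summits.BirchSwinnertonDyer.BirchSwinnertonDyer.Theorems.GoldfeldGoodTwistsRootNumber
import Literature.NumberTheory.EllipticCurves.BSDRootNumberModularityOnlyProofs
import Literature.NumberTheory.EllipticCurves.BSDSelmerSmithDecomposition
import HarnessLib

/-!
# Goldfeld's `50 / 50` in the good family of twists of `X₀(49)`

Cell `bsd-goldfeld` (planner seat), file 5 = the Goldfeld clause of the cell target. Theorems only —
no named fact, no axiom, no definition.

For `E₀ = X₀(49) = 49a1` (the tree's `cm7`) and `𝓕 = {d squarefree : d ≡ 1 (mod 4)}` (the twists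
with good — automatically ordinary — reduction at `2`), as `X → ∞`:

* `50 %` of `d ∈ 𝓕`, `|d| ≤ X`, have `ord_{s=1} L(E₀^{(d)}, s) = rank E₀^{(d)}(ℚ) = 0` and
  `Ш(E₀^{(d)}/ℚ)` finite (`goldfeld_rankZero_half_twists_of_X049`);
* `50 %` have `ord_{s=1} L(E₀^{(d)}, s) = rank E₀^{(d)}(ℚ) = 1` and `Ш(E₀^{(d)}/ℚ)` finite
  (`goldfeld_rankOne_half_twists_of_X049`);

conditional on exactly the named facts of file 3 (`smith_selmerCorank_density cm7` — Smith 2025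
Thm. 1.1; Burungale–Tian rank zero; BCST Thm. A (scope caveat at `p = 2` recorded in file 3);
Gross–Zagier–Kolyvagin) plus the Modularity Theorem `exists_isNewformOf` for the parity
`(−1)^{r_an} = w` (`even_analyticRank_iff_rootNumber_eq_one_of_exists_isNewformOf`) and the
root-number equidistribution in `𝓕` (file 4). The general statements
(`tendsto_familyProportion_rankZero` / `…rankOne`) are for any globally minimal CM elliptic curve
with good ordinary reduction at `2`; `bsdRank_and_goldfeld_twists_of_X049_of_smith_inputs` takes instead the
print-level inputs of the tree's proved assembly `smith_selmerCorank_density_holds_of`.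

HONEST FRAMING. This is Goldfeld's conjecture in A. Smith's formulation ("`100 %` of the twists have
analytic rank `≤ 1`, split `50 / 50`", arXiv:2503.17619 Thm. 1.1 ⇒ Cor. 1.2 under BSD) made
unconditional-modulo-named-facts for the positive-proportion subfamily `𝓕` of ONE CM curve, where the
needed `2`-converse theorems are in print; it is not the average-rank form and says nothing about
`d ≢ 1 (mod 4)` (additive reduction at `2`).

References: D. Goldfeld, *Conjectures on elliptic curves over quadratic fields*, LNM 751 (1979);
A. Smith, arXiv:2503.17619, Thm. 1.1, Cor. 1.2 [arXiv250317619] [SmithGoldfeld2025]; A. Burungale,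
Y. Tian, Ann. of Math. 203 (2026) [BurungaleTian2026]; Burungale–Castella–Skinner–Tian (2022), Thm. A
[BurungaleCastellaSkinnerTian2022]; J. Coates, Y. Li, Y. Tian, S. Zhai, Proc. LMS 110 (2015)
[CoatesLiTianZhai2015].
-/

set_option linter.dupNamespace false
set_option autoImplicit false

noncomputable section

open scoped Classical

open Filter Topology WeierstrassCurve Literature.NumberTheory.EllipticCurves
  Literature.NumberTheory.EllipticCurves.BurungaleCastellaSkinnerTian2022
  Literature.NumberTheory.EllipticCurves.ModularForms

namespace Summit.BirchSwinnertonDyer.BirchSwinnertonDyer.Theorems.GoldfeldGoodTwists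

/-! ## §1 Parity on the good set -/

/-- On a twist with `r_an = corank ≤ 1`: `w = +1 ↔ r_an = 0` (Modularity ⇒ `(−1)^{r_an} = w`).
[cite: SilvermanAEC2009, C.16 Thm. 16.3 and remark, p. 451] -/
theorem rootNumber_eq_one_iff_analyticRank_eq_zero (hmod : exists_isNewformOf)
    (V : WeierstrassCurve ℚ) [V.IsElliptic] (hle : V.analyticRank ≤ 1) :
    V.rootNumber = 1 ↔ V.analyticRank = 0 := by
  have hpar : Even V.analyticRank ↔ V.rootNumber = 1 :=
    even_analyticRank_iff_rootNumber_eq_one_of_exists_isNewformOf V hmod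
  rw [← hpar]
  constructor
  · intro hev
    rcases Nat.le_one_iff_eq_zero_or_eq_one.mp hle with h | h
    · exact h
    · rw [h] at hev; exact absurd hev (by decide)
  · intro h; rw [h]; exact Even.zero

/-- On a twist with `r_an = corank ≤ 1`: `w = −1 ↔ r_an = 1`.
[cite: SilvermanAEC2009, C.16 Thm. 16.3 and remark, p. 451] -/
theorem rootNumber_eq_neg_one_iff_analyticRank_eq_one (hmod : exists_isNewformOf)
    (V : WeierstrassCurve ℚ) [V.IsElliptic] (hle : V.analyticRank ≤ 1) :
    V.rootNumber = -1 ↔ V.analyticRank = 1 := by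
  have h0 := rootNumber_eq_one_iff_analyticRank_eq_zero hmod V hle
  constructor
  · intro hw
    rcases Nat.le_one_iff_eq_zero_or_eq_one.mp hle with h | h
    · have := h0.mpr h; rw [hw] at this; exact absurd this (by norm_num)
    · exact h
  · intro h1
    rcases WeierstrassCurve.rootNumber_eq_one_or V with hw | hw
    · have := h0.mp hw; omega
    · exact hw

/-! ## §2 The `50 / 50` split for a CM curve with good ordinary reduction at `2` -/

section General

variable (W : WeierstrassCurve ℚ) [W.IsElliptic] [W.IsGloballyMinimal]

/-- **Even half.** For `W / ℚ` globally minimal with CM and good ordinary reduction at `2`, under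
Smith's distribution theorem for `W`, Burungale–Tian, BCST Thm. A, GZK and Modularity: `50 %` of
the twists `W^d`, `d ∈ 𝓕`, have `ord_{s=1} L(W^d, s) = rank W^d(ℚ) = 0` and finite `Ш`.
[cite: arXiv250317619, Thm. 1.1 and Cor. 1.2] [cite: BurungaleTian2026, Thm. 1.1] -/
theorem tendsto_familyProportion_rankZero
    (hBT : burungaleTian_analyticRank_eq_zero_of_selmerCorank_eq_zero_of_hasCM)
    (hA : thmA_analyticRank_eq_one_of_selmerCorank_eq_one)
    (hGZK : rank_eq_analyticRank_of_analyticRank_le_one) (hmod : exists_isNewformOf)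
    (hCM : W.HasCM) (hgood : W.HasGoodReductionAtPrime 2) (hord : ¬ (2 : ℤ) ∣ W.frobeniusTrace 2)
    (hS : smith_selmerCorank_density W) :
    Tendsto (fun X : ℕ ↦ (Nat.card {d : ℤ | Squarefree d ∧ |d| ≤ (X : ℤ) ∧ (d % 4 = 1 ∧
        ((W.quadraticTwist d).analyticRank = 0 ∧ (W.quadraticTwist d).mordellWeilRank = 0 ∧
          Finite (W.quadraticTwist d).sha))} : ℝ) /
      Nat.card {d : ℤ | Squarefree d ∧ |d| ≤ (X : ℤ) ∧ d % 4 = 1}) atTop (𝓝 (1 / 2)) := by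
  refine tendsto_familyProportion_of_congr_one (tendsto_familyProportion_rootNumber_eq_one W hmod)
    (tendsto_bsdRank_eq_selmerCorankTwoInfty hBT hA hGZK W hCM hgood hord hS)
    fun d hd _ hR ↦ ?_
  obtain ⟨hle, hra, hrk, hsha⟩ := hR
  haveI := W.isElliptic_quadraticTwist (d := (d : ℚ)) (by exact_mod_cast hd.ne_zero)
  rw [rootNumber_eq_one_iff_analyticRank_eq_zero hmod _ (hra ▸ hle)]
  constructor
  · intro h0; exact ⟨h0, by rw [hrk, ← hra, h0], hsha⟩
  · exact fun h ↦ h.1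

/-- **Odd half.** Same hypotheses: `50 %` of the twists `W^d`, `d ∈ 𝓕`, have
`ord_{s=1} L(W^d, s) = rank W^d(ℚ) = 1` and finite `Ш`.
[cite: arXiv250317619, Thm. 1.1 and Cor. 1.2] [cite: BurungaleCastellaSkinnerTian2022, Thm. A] -/
theorem tendsto_familyProportion_rankOne
    (hBT : burungaleTian_analyticRank_eq_zero_of_selmerCorank_eq_zero_of_hasCM)
    (hA : thmA_analyticRank_eq_one_of_selmerCorank_eq_one)
    (hGZK : rank_eq_analyticRank_of_analyticRank_le_one) (hmod : exists_isNewformOf)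
    (hCM : W.HasCM) (hgood : W.HasGoodReductionAtPrime 2) (hord : ¬ (2 : ℤ) ∣ W.frobeniusTrace 2)
    (hS : smith_selmerCorank_density W) :
    Tendsto (fun X : ℕ ↦ (Nat.card {d : ℤ | Squarefree d ∧ |d| ≤ (X : ℤ) ∧ (d % 4 = 1 ∧
        ((W.quadraticTwist d).analyticRank = 1 ∧ (W.quadraticTwist d).mordellWeilRank = 1 ∧
          Finite (W.quadraticTwist d).sha))} : ℝ) /
      Nat.card {d : ℤ | Squarefree d ∧ |d| ≤ (X : ℤ) ∧ d % 4 = 1}) atTop (𝓝 (1 / 2)) := by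
  refine tendsto_familyProportion_of_congr_one
    (tendsto_familyProportion_rootNumber_eq_neg_one W hmod)
    (tendsto_bsdRank_eq_selmerCorankTwoInfty hBT hA hGZK W hCM hgood hord hS)
    fun d hd _ hR ↦ ?_
  obtain ⟨hle, hra, hrk, hsha⟩ := hR
  haveI := W.isElliptic_quadraticTwist (d := (d : ℚ)) (by exact_mod_cast hd.ne_zero)
  rw [rootNumber_eq_neg_one_iff_analyticRank_eq_one hmod _ (hra ▸ hle)]
  constructor
  · intro h1; exact ⟨h1, by rw [hrk, ← hra, h1], hsha⟩
  · exact fun h ↦ h.1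

end General

/-! ## §3 `E₀ = X₀(49) = 49a1` -/

/-- **Goldfeld, even half, for `X₀(49)`.** For `50 %` of the squarefree `d ≡ 1 (mod 4)`:
`ord_{s=1} L(E₀^{(d)}, s) = rank E₀^{(d)}(ℚ) = 0` and `Ш(E₀^{(d)}/ℚ)` is finite, `E₀ = 49a1`.
[cite: arXiv250317619, Thm. 1.1 and Cor. 1.2] [cite: BurungaleTian2026, Thm. 1.1]
[cite: CoatesLiTianZhai2015, Thm. 1.1] -/
theorem goldfeld_rankZero_half_twists_of_X049
    (hS : smith_selmerCorank_density cm7)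
    (hBT : burungaleTian_analyticRank_eq_zero_of_selmerCorank_eq_zero_of_hasCM)
    (hA : thmA_analyticRank_eq_one_of_selmerCorank_eq_one)
    (hGZK : rank_eq_analyticRank_of_analyticRank_le_one) (hmod : exists_isNewformOf) :
    Tendsto (fun X : ℕ ↦ (Nat.card {d : ℤ | Squarefree d ∧ |d| ≤ (X : ℤ) ∧ (d % 4 = 1 ∧
        ((cm7.quadraticTwist d).analyticRank = 0 ∧ (cm7.quadraticTwist d).mordellWeilRank = 0 ∧
          Finite (cm7.quadraticTwist d).sha))} : ℝ) /
      Nat.card {d : ℤ | Squarefree d ∧ |d| ≤ (X : ℤ) ∧ d % 4 = 1}) atTop (𝓝 (1 / 2)) :=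
  tendsto_familyProportion_rankZero cm7 hBT hA hGZK hmod (hasCM_of_j_eq_neg3375 cm7 j_cm7)
    hasGoodReductionAtPrime_cm7_two (by rw [frobeniusTrace_cm7_two]; norm_num) hS

/-- **Goldfeld, odd half, for `X₀(49)`.** For `50 %` of the squarefree `d ≡ 1 (mod 4)`:
`ord_{s=1} L(E₀^{(d)}, s) = rank E₀^{(d)}(ℚ) = 1` and `Ш(E₀^{(d)}/ℚ)` is finite, `E₀ = 49a1`.
[cite: arXiv250317619, Thm. 1.1 and Cor. 1.2] [cite: BurungaleCastellaSkinnerTian2022, Thm. A]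
[cite: CoatesLiTianZhai2015, Thm. 1.1] -/
theorem goldfeld_rankOne_half_twists_of_X049
    (hS : smith_selmerCorank_density cm7)
    (hBT : burungaleTian_analyticRank_eq_zero_of_selmerCorank_eq_zero_of_hasCM)
    (hA : thmA_analyticRank_eq_one_of_selmerCorank_eq_one)
    (hGZK : rank_eq_analyticRank_of_analyticRank_le_one) (hmod : exists_isNewformOf) :
    Tendsto (fun X : ℕ ↦ (Nat.card {d : ℤ | Squarefree d ∧ |d| ≤ (X : ℤ) ∧ (d % 4 = 1 ∧
        ((cm7.quadraticTwist d).analyticRank = 1 ∧ (cm7.quadraticTwist d).mordellWeilRank = 1 ∧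
          Finite (cm7.quadraticTwist d).sha))} : ℝ) /
      Nat.card {d : ℤ | Squarefree d ∧ |d| ≤ (X : ℤ) ∧ d % 4 = 1}) atTop (𝓝 (1 / 2)) :=
  tendsto_familyProportion_rankOne cm7 hBT hA hGZK hmod (hasCM_of_j_eq_neg3375 cm7 j_cm7)
    hasGoodReductionAtPrime_cm7_two (by rw [frobeniusTrace_cm7_two]; norm_num) hS

/-- **The cell target, all clauses** (`bsd-goldfeld`): for the good family `𝓕` of quadratic twists
of `E₀ = X₀(49)` — (i) rank BSD with finite `Ш` for `100 %` of `𝓕`; (ii) rank `0` for `50 %`;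
(iii) rank `1` for `50 %`. Hypotheses = the tree's named facts (Smith Thm. 1.1 for `E₀`,
Burungale–Tian, BCST Thm. A, GZK, Modularity).
Print status (the cell's `HYPOTHESIS-TABLE.md`, `R1-AUDIT.md`): `hS` follows from refereed print —
[Smi22a] Thm. 1.2, J. Amer. Math. Soc. 39 (2026) — either via `…_of_smith_inputs` below (with
Thm. 1.17 IV/V of arXiv:2503.17619 and Monsky) or via Smith's Case II for `X₀(49)`
(`GoldfeldGoodTwistsSmithCaseII`, `GoldfeldGoodTwistsPublishedInputs`: [Smi22a] alone); `hBT` is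
Ann. of Math. 203 (2026), Thm. 1.1; `hGZK`, `hmod` are classical. The one print-level caveat is
`hA` = [BCST, Thm. A] AT `p = 2` as stated: asserted in refereed print (BCST 2022;
Burungale–Skinner 2022, App. A Thm. 10.3; Li–Tian–Yan–Zhu 2025) but without a complete printed proof
at `p = 2` (the `Λ`-adic explicit reciprocity law, BCST Thm. 5.1, is in print for odd `p` only).
All three clauses here invoke `hA` — (ii) through the root-number dictionary on the density-one
set; the form of the even half that does not (density exactly `1/2` of
`ord_{s=1} L = rank = 0 ∧ Ш finite` among ALL squarefree `d`, from [Smi22a] + `hBT` + `hGZK`) is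
`goldfeld_rankZero_half_allTwists_of_X049` in `GoldfeldGoodTwistsPublishedInputs`.
[cite: arXiv250317619, Thm. 1.1 and Cor. 1.2] [cite: BurungaleTian2026, Thm. 1.1]
[cite: BurungaleCastellaSkinnerTian2022, Thm. A] -/
theorem bsdRank_and_goldfeld_twists_of_X049
    (hS : smith_selmerCorank_density cm7)
    (hBT : burungaleTian_analyticRank_eq_zero_of_selmerCorank_eq_zero_of_hasCM)
    (hA : thmA_analyticRank_eq_one_of_selmerCorank_eq_one)
    (hGZK : rank_eq_analyticRank_of_analyticRank_le_one) (hmod : exists_isNewformOf) :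
    Tendsto (fun X : ℕ ↦ (Nat.card {d : ℤ | Squarefree d ∧ |d| ≤ (X : ℤ) ∧ (d % 4 = 1 ∧
        ((cm7.quadraticTwist d).analyticRank = (cm7.quadraticTwist d).mordellWeilRank ∧
          Finite (cm7.quadraticTwist d).sha))} : ℝ) /
      Nat.card {d : ℤ | Squarefree d ∧ |d| ≤ (X : ℤ) ∧ d % 4 = 1}) atTop (𝓝 1) ∧
    Tendsto (fun X : ℕ ↦ (Nat.card {d : ℤ | Squarefree d ∧ |d| ≤ (X : ℤ) ∧ (d % 4 = 1 ∧
        ((cm7.quadraticTwist d).analyticRank = 0 ∧ (cm7.quadraticTwist d).mordellWeilRank = 0 ∧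
          Finite (cm7.quadraticTwist d).sha))} : ℝ) /
      Nat.card {d : ℤ | Squarefree d ∧ |d| ≤ (X : ℤ) ∧ d % 4 = 1}) atTop (𝓝 (1 / 2)) ∧
    Tendsto (fun X : ℕ ↦ (Nat.card {d : ℤ | Squarefree d ∧ |d| ≤ (X : ℤ) ∧ (d % 4 = 1 ∧
        ((cm7.quadraticTwist d).analyticRank = 1 ∧ (cm7.quadraticTwist d).mordellWeilRank = 1 ∧
          Finite (cm7.quadraticTwist d).sha))} : ℝ) /
      Nat.card {d : ℤ | Squarefree d ∧ |d| ≤ (X : ℤ) ∧ d % 4 = 1}) atTop (𝓝 (1 / 2)) :=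
  ⟨bsdRank_densityOne_twists_of_X049 hS hBT hA hGZK,
    goldfeld_rankZero_half_twists_of_X049 hS hBT hA hGZK hmod,
    goldfeld_rankOne_half_twists_of_X049 hS hBT hA hGZK hmod⟩

/-- **The cell target from the print-level inputs of Smith's theorem.** The same three clauses with
`smith_selmerCorank_density cm7` discharged by the tree's PROVED assembly of Smith's Thm. 1.1
(`smith_selmerCorank_density_holds_of`) from its published inputs: [Smi22a] Thm. 1.2 (`h22`),
arXiv:2503.17619 Thm. 1.17 Cases IV/V (`h17IV`, `h17V`), Monsky's `2`-parity congruence (`hMon`)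
and Modularity (`hmod`). [cite: arXiv250317619, Thm. 1.1 (proof, §1.1), Cor. 1.2]
[cite: Smith2022SelmerTwistI, Thm. 1.2] [cite: BurungaleTian2026, Thm. 1.1]
[cite: BurungaleCastellaSkinnerTian2022, Thm. A] -/
theorem bsdRank_and_goldfeld_twists_of_X049_of_smith_inputs (hmod : exists_isNewformOf)
    (hMon : monsky_selmerCorank_two_mod_two_eq) (h22 : smith2022_selmerCorank_distribution)
    (h17IV : smith2025_thm117_caseIV) (h17V : smith2025_thm117_caseV)
    (hBT : burungaleTian_analyticRank_eq_zero_of_selmerCorank_eq_zero_of_hasCM)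
    (hA : thmA_analyticRank_eq_one_of_selmerCorank_eq_one)
    (hGZK : rank_eq_analyticRank_of_analyticRank_le_one) :
    Tendsto (fun X : ℕ ↦ (Nat.card {d : ℤ | Squarefree d ∧ |d| ≤ (X : ℤ) ∧ (d % 4 = 1 ∧
        ((cm7.quadraticTwist d).analyticRank = (cm7.quadraticTwist d).mordellWeilRank ∧
          Finite (cm7.quadraticTwist d).sha))} : ℝ) /
      Nat.card {d : ℤ | Squarefree d ∧ |d| ≤ (X : ℤ) ∧ d % 4 = 1}) atTop (𝓝 1) ∧
    Tendsto (fun X : ℕ ↦ (Nat.card {d : ℤ | Squarefree d ∧ |d| ≤ (X : ℤ) ∧ (d % 4 = 1 ∧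
        ((cm7.quadraticTwist d).analyticRank = 0 ∧ (cm7.quadraticTwist d).mordellWeilRank = 0 ∧
          Finite (cm7.quadraticTwist d).sha))} : ℝ) /
      Nat.card {d : ℤ | Squarefree d ∧ |d| ≤ (X : ℤ) ∧ d % 4 = 1}) atTop (𝓝 (1 / 2)) ∧
    Tendsto (fun X : ℕ ↦ (Nat.card {d : ℤ | Squarefree d ∧ |d| ≤ (X : ℤ) ∧ (d % 4 = 1 ∧
        ((cm7.quadraticTwist d).analyticRank = 1 ∧ (cm7.quadraticTwist d).mordellWeilRank = 1 ∧
          Finite (cm7.quadraticTwist d).sha))} : ℝ) /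
      Nat.card {d : ℤ | Squarefree d ∧ |d| ≤ (X : ℤ) ∧ d % 4 = 1}) atTop (𝓝 (1 / 2)) :=
  bsdRank_and_goldfeld_twists_of_X049 (smith_selmerCorank_density_holds_of hmod hMon h22 h17IV h17V cm7)
    hBT hA hGZK hmod

end Summit.BirchSwinnertonDyer.BirchSwinnertonDyer.Theorems.GoldfeldGoodTwists

end
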